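import Summits.QuantumFields.YangMills.Theses.ConvexGribovBody
import Summits.QuantumFields.YangMills.Theorems.PoincareToGap.Negative.Tightness
import Summits.QuantumFields.YangMills.Theorems.PoincareToGap.Negative.PlaquetteVariance
import Summits.QuantumFields.YangMills.Theorems.BrascampLiebVacuum.Negative.FalseWithoutLocality

/-!
# `NonSimplyConnectedLatticeGap` — negative lemma: the time bound `n ≤ S` is load-bearing

Negative-side support for crux `stmt-QuantumFields-16405`
(`Summit.QuantumFields.YangMills.Theses.ConvexGribovBody.NonSimplyConnectedLatticeGap`: for every
compact simple `G` with `¬ SimplyConnectedSpace G` and every faithful unitary `r`, `∃ β₀, ∀ β ≥ β₀,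
∃ m > 0, ∃ S₁, ∀ A B, ∃ C, ∀ S n, S₁ ≤ S → n ≤ S → |corr_S(A,B,n)| ≤ C e^{-m n}` under Wilson's torus
measure), from the standing disprover's work file `Cruxes/NonSimplyConnectedLatticeGap/Disproof.lean`
§A1. The crux concludes the same clustering body as `PoincareToGap` (crux 8781), so the periodicity
and volume-uniform plaquette-variance lemmas of `PoincareToGap.Negative` apply verbatim:

* `nonSimplyConnectedLatticeGap_false_without_timeBound_at` — for EVERY `(G, r)` admitted by the
  crux (only `∃ a ≠ 1` of `IsCompactSimpleLieGroup` is used; `¬ SimplyConnectedSpace` is not) and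
  whatever `β₀`, the body with `n ≤ S` deleted is false: `corr_S(A,A,k(2S+1)) = corr_S(A,A,0) =
  Var_S(A) ≥ v(β₀) > 0` for the plaquette, uniformly in `S ≥ 1`. Any proof of the crux must use
  `n ≤ S` (it is what makes the thermal wrap-around `e^{-m(2S+1-n)} ≤ e^{-m(n+1)}` harmless).

Nothing here asserts a Theses statement.
-/

noncomputable section

namespace Summit.QuantumFields.YangMills.Theorems.NonSimplyConnectedLatticeGap.Negative

open MeasureTheory
open Literature.MathematicalPhysics.QuantumFieldTheory

variable {G : Type} [Group G] [TopologicalSpace G] [IsTopologicalGroup G] [CompactSpace G]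
  [MeasurableSpace G] [BorelSpace G]

/-- **The restriction `n ≤ S` of `NonSimplyConnectedLatticeGap` is load-bearing — for EVERY
admissible `(G, r)` and every `β₀`.** The crux body with `n ≤ S` deleted (exponential clustering
demanded at all separations `n` on the torus of period `2S+1`, from some `β₀` on) is false: by
periodicity `corr_S(A,A,k(2S+1)) = corr_S(A,A,0)`, which for the plaquette is its variance,
bounded below by `v > 0` on every torus `S ≥ 1`
(`PoincareToGap.Negative.exists_cov_lower_bound`, `…not_clusteringAllSep_of_cov_lower_bound`;
`∃ a ≠ 1` from `BrascampLiebVacuum.Negative.exists_ne_one_of_isCompactSimpleLieGroup`).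
[folklore] -/
theorem nonSimplyConnectedLatticeGap_false_without_timeBound_at (hG : IsCompactSimpleLieGroup G)
    (r : LatticeRep G) :
    ¬ (∃ β₀ : ℝ, ∀ β : ℝ, β₀ ≤ β → ∃ m : ℝ, 0 < m ∧ ∃ S₁ : ℕ, ∀ A B : YMSpecies G, ∃ C : ℝ,
      ∀ S n : ℕ, S₁ ≤ S →
      |latticeConnectedCorr r.ρ β (2 * S + 1) A.F B.F n| ≤ C * Real.exp (-(m * n))) := by
  rintro ⟨β₀, h⟩
  obtain ⟨g₀, hg₀⟩ := BrascampLiebVacuum.Negative.exists_ne_one_of_isCompactSimpleLieGroup hG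
  obtain ⟨A, v, hv, hA⟩ := PoincareToGap.Negative.exists_cov_lower_bound r hg₀ β₀
  exact PoincareToGap.Negative.not_clusteringAllSep_of_cov_lower_bound r β₀ A A hv
    (fun S₁ => ⟨max S₁ 1, le_max_left _ _, hA _ (le_max_right _ _)⟩) (h β₀ le_rfl)

end Summit.QuantumFields.YangMills.Theorems.NonSimplyConnectedLatticeGap.Negative

end
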